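import Mathlib.Topology.Maps.Proper.Basic
import Mathlib.Topology.Separation.Hausdorff

/-!
# Parametrised inverses on compact fibres are jointly continuous (closed graph + compact fibre)

A classical, derivative-free fact of point-set topology, in the `ContinuousOn`/set form that measure-theoretic
consumers need.

**Setting.**  `P` (parameters), `X`, `Y` topological spaces, `Y` Hausdorff; a family of *windows* `K p ⊆ X`, all inside one
compact set `C ⊆ X`, whose graph `W = {(p, x) | x ∈ K p}` is closed in `P × X`; a parametrised map `F : P → X → Y`,
jointly continuous on `W`; and ANY family of left inverses `ϑ p` of `F p` on `K p` (`ϑ p (F p x) = x` for `x ∈ K p`; no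
measurability, continuity or formula for `ϑ` is assumed).

**Theorem** (`continuousOn_parametricInverse`).  `(p, y) ↦ ϑ p y` is continuous on the *image graph*
`D = {(p, y) | y ∈ F p '' K p}`, and `D` is closed (`isClosed_parametricImageGraph`).

*Proof.*  The graph `Γ = {((p, y), x) | x ∈ K p, F p x = y}` of the inverse over `D` is closed (continuity of `F` on the
closed set `W`, closed diagonal of `Y`), its `X`-coordinates lie in the compact `C`, and the first projection along a
compact factor is a closed map (Mathlib `isClosedMap_fst_of_compactSpace`); a map whose graph is so cut out is continuous
(`continuousOn_of_isClosed_graph_of_isCompact`, the set edition of the closed-graph theorem for compact codomain — the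
whole-space edition is `Literature.NumberTheory.GaloisRepresentations.continuous_of_isClosed_graph`, not restated).

The NON-parametric edition (one `p`: the inverse of a continuous injection on a compact set is continuous on the image) is
already in the tree three times (`Literature.Topology.PlaneTopology.Schoenflies.continuousOn_invFunOn`,
`Literature.Topology.FourManifolds.CellularSets.continuousOn_invFunOn_image_of_isCompact`,
`Literature.Probability.RandomPlanarGeometry.ConformalRectangleProofs.continuousOn_invFunOn_of_isCompact`) and is NOT
restated here; it is the special case `P = Unit` of `continuousOn_parametricInverse_fibre`.

References: N. Bourbaki, *General Topology* Ch. I §10.2 (proper maps; Cor. 5 to Thm 1: the projection along a compact factor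
is proper, hence closed), Ch. I §10 Exerc. 14 (a map into a compact space is continuous iff its graph is closed), Ch. I §8
no. 1 (Hausdorff ⟺ closed diagonal; closed graphs), Ch. I §9 no. 4 Thm 2 Cor. 2 (continuous bijections of compact spaces onto
Hausdorff spaces are homeomorphisms) [cite: BourbakiGT1, Ch. I §10 no. 2 Thm 1 Cor. 5; Ch. I §10 Exerc. 14; Ch. I §9 no. 4 Thm 2
Cor. 2]; the parametrised form is the routine combination of these.
-/

namespace Literature.Topology.ParametricInverse

open Set Function Filter Topology

variable {P X Y Z : Type*} [TopologicalSpace P] [TopologicalSpace X] [TopologicalSpace Y] [TopologicalSpace Z]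

/-! ## §1  Closed-graph continuity with a compact window -/

/-- The first projection of a closed set `Γ ⊆ Z × X` whose second coordinates lie in a compact set `C` is closed
(pull back to `Z × ↥C` and use that the projection along a compact factor is proper, hence closed). [cite: BourbakiGT1, Ch. I §10 no. 2, Thm 1 Cor. 5] -/
theorem isClosed_image_fst_of_subset_isCompact {Γ : Set (Z × X)} {C : Set X} (hC : IsCompact C)
    (hΓ : IsClosed Γ) (hΓC : ∀ r ∈ Γ, r.2 ∈ C) : IsClosed (Prod.fst '' Γ) := by
  haveI : CompactSpace C := isCompact_iff_compactSpace.mp hC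
  have he : Continuous fun q : Z × C => ((q.1, (q.2 : X)) : Z × X) :=
    continuous_fst.prodMk (continuous_subtype_val.comp continuous_snd)
  have himg : Prod.fst '' Γ = Prod.fst '' ((fun q : Z × C => ((q.1, (q.2 : X)) : Z × X)) ⁻¹' Γ) := by
    ext z
    constructor
    · rintro ⟨r, hr, rfl⟩
      exact ⟨(r.1, ⟨r.2, hΓC r hr⟩), by simpa using hr, rfl⟩
    · rintro ⟨q, hq, rfl⟩
      exact ⟨(q.1, (q.2 : X)), hq, rfl⟩
  rw [himg]
  exact isClosedMap_fst_of_compactSpace _ (hΓ.preimage he)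

/-- **Closed-graph continuity, set edition with a compact window.**  Let `f : P → X`, `s ⊆ P`, and `Γ ⊆ P × X` a CLOSED
set whose second coordinates lie in a compact set `C` and which cuts out the graph of `f` over `s` (`(p, f p) ∈ Γ` for
`p ∈ s`, and `(p, x) ∈ Γ ⇒ x = f p` for `p ∈ s`).  Then `f` is continuous on `s`.  (Whole-space edition:
`Literature.NumberTheory.GaloisRepresentations.continuous_of_isClosed_graph`.) [cite: BourbakiGT1, Ch. I §10 Exerc. 14] [cite: BourbakiGT1, Ch. I §10 no. 2, Thm 1 Cor. 5] -/
theorem continuousOn_of_isClosed_graph_of_isCompact {f : P → X} {s : Set P} {Γ : Set (P × X)} {C : Set X}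
    (hC : IsCompact C) (hΓ : IsClosed Γ) (hΓC : ∀ r ∈ Γ, r.2 ∈ C)
    (hmem : ∀ p ∈ s, (p, f p) ∈ Γ) (huniq : ∀ p ∈ s, ∀ x, (p, x) ∈ Γ → x = f p) : ContinuousOn f s := by
  rw [continuousOn_iff_isClosed]
  intro t ht
  refine ⟨Prod.fst '' (Γ ∩ Prod.snd ⁻¹' t),
    isClosed_image_fst_of_subset_isCompact hC (hΓ.inter (ht.preimage continuous_snd)) fun r hr => hΓC r hr.1, ?_⟩
  ext p
  constructor
  · rintro ⟨hpt, hps⟩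
    exact ⟨⟨(p, f p), ⟨hmem p hps, hpt⟩, rfl⟩, hps⟩
  · rintro ⟨⟨r, ⟨hrΓ, hrt⟩, hrp⟩, hps⟩
    obtain ⟨p', x⟩ := r
    have hp' : p' = p := hrp
    subst hp'
    refine ⟨?_, hps⟩
    show f p' ∈ t
    rw [← huniq p' hps x hrΓ]
    exact hrt

/-- Closed-graph continuity, set edition, compact codomain. [cite: BourbakiGT1, Ch. I §10 Exerc. 14] -/
theorem continuousOn_of_isClosed_graph [CompactSpace X] {f : P → X} {s : Set P} {Γ : Set (P × X)}
    (hΓ : IsClosed Γ) (hmem : ∀ p ∈ s, (p, f p) ∈ Γ) (huniq : ∀ p ∈ s, ∀ x, (p, x) ∈ Γ → x = f p) :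
    ContinuousOn f s :=
  continuousOn_of_isClosed_graph_of_isCompact isCompact_univ hΓ (fun _ _ => mem_univ _) hmem huniq

/-! ## §2  The graph of a parametrised inverse is closed -/

section Parametric

variable [T2Space Y] {F : P → X → Y} {K : P → Set X} {ϑ : P → Y → X} {C : Set X}

/-- The graph `{((p, y), x) | x ∈ K p, F p x = y}` of the parametrised inverse is closed, as soon as the window graph
`{(p, x) | x ∈ K p}` is closed and `F` is jointly continuous on it (`Y` Hausdorff: the diagonal is closed). [cite: BourbakiGT1, Ch. I §8 no. 1, Prop. 1 and Prop. 2 Cor. 2] -/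
theorem isClosed_parametricGraph (hW : IsClosed {q : P × X | q.2 ∈ K q.1})
    (hF : ContinuousOn (fun q : P × X => F q.1 q.2) {q : P × X | q.2 ∈ K q.1}) :
    IsClosed {r : (P × Y) × X | r.2 ∈ K r.1.1 ∧ F r.1.1 r.2 = r.1.2} := by
  have hA : IsClosed {r : (P × Y) × X | r.2 ∈ K r.1.1} :=
    hW.preimage ((continuous_fst.comp continuous_fst).prodMk continuous_snd)
  have hφ : ContinuousOn (fun r : (P × Y) × X => (F r.1.1 r.2, r.1.2)) {r : (P × Y) × X | r.2 ∈ K r.1.1} := by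
    refine ContinuousOn.prodMk ?_ (continuous_snd.comp continuous_fst).continuousOn
    exact hF.comp ((continuous_fst.comp continuous_fst).prodMk continuous_snd).continuousOn fun r hr => hr
  have h := hφ.preimage_isClosed_of_isClosed hA isClosed_diagonal
  have heq : {r : (P × Y) × X | r.2 ∈ K r.1.1 ∧ F r.1.1 r.2 = r.1.2} =
      {r : (P × Y) × X | r.2 ∈ K r.1.1} ∩ (fun r : (P × Y) × X => (F r.1.1 r.2, r.1.2)) ⁻¹' diagonal Y := by
    ext r
    simp only [mem_setOf_eq, mem_inter_iff, mem_preimage, mem_diagonal_iff]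
  rw [heq]
  exact h

/-- Each window `K p` is closed (a section of the closed window graph). [cite: BourbakiGT1, Ch. I §4 no. 2, Prop. 5 Cor.] -/
theorem isClosed_window (hW : IsClosed {q : P × X | q.2 ∈ K q.1}) (p : P) : IsClosed (K p) := by
  have h : IsClosed ((fun x : X => ((p, x) : P × X)) ⁻¹' {q : P × X | q.2 ∈ K q.1}) :=
    hW.preimage (continuous_const.prodMk continuous_id)
  simpa using h

/-- Each window `K p` is compact (closed inside the compact `C`). [cite: BourbakiGT1, Ch. I §9 no. 3, Prop. 2] -/
theorem isCompact_window (hC : IsCompact C) (hKC : ∀ p, K p ⊆ C) (hW : IsClosed {q : P × X | q.2 ∈ K q.1}) (p : P) :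
    IsCompact (K p) :=
  hC.of_isClosed_subset (isClosed_window hW p) (hKC p)

omit [T2Space Y] in
/-- Each image window `F p '' K p` is compact (continuous image of a compact set). [cite: BourbakiGT1, Ch. I §9 no. 4, Thm 2 Cor. 1] -/
theorem isCompact_parametricImage (hC : IsCompact C) (hKC : ∀ p, K p ⊆ C) (hW : IsClosed {q : P × X | q.2 ∈ K q.1})
    (hF : ContinuousOn (fun q : P × X => F q.1 q.2) {q : P × X | q.2 ∈ K q.1}) (p : P) : IsCompact (F p '' K p) :=
  (isCompact_window hC hKC hW p).image_of_continuousOn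
    (hF.comp (continuous_const.prodMk continuous_id).continuousOn fun _ hx => hx)

/-! ## §3  Joint continuity of the parametrised inverse on the image graph -/

/-- ★★★ **PARAMETRISED INVERSES ON COMPACT FIBRES ARE JOINTLY CONTINUOUS.**  Let the window graph `{(p, x) | x ∈ K p}` be
closed, every `K p ⊆ C` with `C` compact, `F` jointly continuous on the window graph, `Y` Hausdorff, and `ϑ p` any left
inverse of `F p` on `K p`.  Then `(p, y) ↦ ϑ p y` is continuous on the image graph `{(p, y) | y ∈ F p '' K p}`.
(No formula for `ϑ` off the image graph matters; no derivative is used.)  The parametrised form of «the inverse of a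
continuous bijection of a compact space onto a Hausdorff space is continuous» (ibid. Ch. I §9 no. 4, Thm 2 Cor. 2), proved from
BourbakiGT1, Ch. I §10 no. 2, Thm 1 Cor. 5 and BourbakiGT1, Ch. I §10 Exerc. 14. [cite: BourbakiGT1, Ch. I §10 no. 2, Thm 1 Cor. 5] -/
theorem continuousOn_parametricInverse (hC : IsCompact C) (hKC : ∀ p, K p ⊆ C)
    (hW : IsClosed {q : P × X | q.2 ∈ K q.1})
    (hF : ContinuousOn (fun q : P × X => F q.1 q.2) {q : P × X | q.2 ∈ K q.1})
    (hleft : ∀ p, ∀ x ∈ K p, ϑ p (F p x) = x) :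
    ContinuousOn (fun q : P × Y => ϑ q.1 q.2) {q : P × Y | q.2 ∈ F q.1 '' K q.1} := by
  refine continuousOn_of_isClosed_graph_of_isCompact hC (isClosed_parametricGraph hW hF) (fun r hr => hKC _ hr.1)
    ?_ ?_
  · rintro q ⟨x, hx, hqx⟩
    refine ⟨?_, ?_⟩
    · show ϑ q.1 q.2 ∈ K q.1
      rw [← hqx, hleft _ x hx]
      exact hx
    · show F q.1 (ϑ q.1 q.2) = q.2
      rw [← hqx, hleft _ x hx]
  · rintro q - x ⟨hxK, hFx⟩
    show x = ϑ q.1 q.2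
    rw [← hFx, hleft _ x hxK]

/-- ★ **THE IMAGE GRAPH IS CLOSED**: `{(p, y) | y ∈ F p '' K p}` is a closed subset of `P × Y` (first projection of the closed
graph of §2 along the compact window). [cite: BourbakiGT1, Ch. I §10 no. 2, Thm 1 Cor. 5] -/
theorem isClosed_parametricImageGraph (hC : IsCompact C) (hKC : ∀ p, K p ⊆ C)
    (hW : IsClosed {q : P × X | q.2 ∈ K q.1})
    (hF : ContinuousOn (fun q : P × X => F q.1 q.2) {q : P × X | q.2 ∈ K q.1}) :
    IsClosed {q : P × Y | q.2 ∈ F q.1 '' K q.1} := by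
  have h := isClosed_image_fst_of_subset_isCompact hC (isClosed_parametricGraph hW hF) fun r hr => hKC _ hr.1
  have heq : {q : P × Y | q.2 ∈ F q.1 '' K q.1} =
      Prod.fst '' {r : (P × Y) × X | r.2 ∈ K r.1.1 ∧ F r.1.1 r.2 = r.1.2} := by
    ext q
    constructor
    · rintro ⟨x, hx, hqx⟩
      exact ⟨(q, x), ⟨hx, hqx⟩, rfl⟩
    · rintro ⟨r, hr, rfl⟩
      exact ⟨r.2, hr.1, hr.2⟩
  rw [heq]
  exact h

/-- Continuity of the inverse IN THE PARAMETER at a fixed value `y`: `p ↦ ϑ p y` is continuous on `{p | y ∈ F p '' K p}`.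
[cite: BourbakiGT1, Ch. I §10 no. 2, Thm 1 Cor. 5] -/
theorem continuousOn_parametricInverse_param (hC : IsCompact C) (hKC : ∀ p, K p ⊆ C)
    (hW : IsClosed {q : P × X | q.2 ∈ K q.1})
    (hF : ContinuousOn (fun q : P × X => F q.1 q.2) {q : P × X | q.2 ∈ K q.1})
    (hleft : ∀ p, ∀ x ∈ K p, ϑ p (F p x) = x) (y : Y) :
    ContinuousOn (fun p => ϑ p y) {p : P | y ∈ F p '' K p} :=
  (continuousOn_parametricInverse hC hKC hW hF hleft).comp (continuous_id.prodMk continuous_const).continuousOn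
    fun _ hp => hp

/-- Continuity of the inverse IN THE VALUE at a fixed parameter `p`: `ϑ p` is continuous on `F p '' K p` (the non-parametric
edition; cf. `Literature.Topology.PlaneTopology.Schoenflies.continuousOn_invFunOn` for `invFunOn`).
[cite: BourbakiGT1, Ch. I §9 no. 4, Thm 2 Cor. 2] -/
theorem continuousOn_parametricInverse_fibre (hC : IsCompact C) (hKC : ∀ p, K p ⊆ C)
    (hW : IsClosed {q : P × X | q.2 ∈ K q.1})
    (hF : ContinuousOn (fun q : P × X => F q.1 q.2) {q : P × X | q.2 ∈ K q.1})
    (hleft : ∀ p, ∀ x ∈ K p, ϑ p (F p x) = x) (p : P) :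
    ContinuousOn (ϑ p) (F p '' K p) :=
  (continuousOn_parametricInverse hC hKC hW hF hleft).comp (continuous_const.prodMk continuous_id).continuousOn
    fun _ hy => hy

/-- At an interior point of the image graph the parametrised inverse is (jointly) `ContinuousAt`. [cite: BourbakiGT1, Ch. I §10 no. 2, Thm 1 Cor. 5] -/
theorem continuousAt_parametricInverse_of_mem_interior (hC : IsCompact C) (hKC : ∀ p, K p ⊆ C)
    (hW : IsClosed {q : P × X | q.2 ∈ K q.1})
    (hF : ContinuousOn (fun q : P × X => F q.1 q.2) {q : P × X | q.2 ∈ K q.1})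
    (hleft : ∀ p, ∀ x ∈ K p, ϑ p (F p x) = x) {q : P × Y}
    (hq : q ∈ interior {q : P × Y | q.2 ∈ F q.1 '' K q.1}) :
    ContinuousAt (fun q : P × Y => ϑ q.1 q.2) q :=
  (continuousOn_parametricInverse hC hKC hW hF hleft).continuousAt (mem_interior_iff_mem_nhds.mp hq)

omit [TopologicalSpace P] [TopologicalSpace X] [TopologicalSpace Y] [T2Space Y] in
/-- The values of the inverse on the image graph lie in the windows: `ϑ p y ∈ K p` for `y ∈ F p '' K p` (set bookkeeping of a
left inverse). [cite: BourbakiGT1, Ch. I §9 no. 4, Thm 2 Cor. 2 (bookkeeping)] -/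
theorem parametricInverse_mem_window (hleft : ∀ p, ∀ x ∈ K p, ϑ p (F p x) = x) {p : P} {y : Y}
    (hy : y ∈ F p '' K p) : ϑ p y ∈ K p := by
  obtain ⟨x, hx, rfl⟩ := hy
  rw [hleft p x hx]
  exact hx

omit [TopologicalSpace P] [TopologicalSpace X] [TopologicalSpace Y] [T2Space Y] in
/-- On the image graph `ϑ p` is a right inverse: `F p (ϑ p y) = y` for `y ∈ F p '' K p` (set bookkeeping of a left inverse).
[cite: BourbakiGT1, Ch. I §9 no. 4, Thm 2 Cor. 2 (bookkeeping)] -/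
theorem apply_parametricInverse (hleft : ∀ p, ∀ x ∈ K p, ϑ p (F p x) = x) {p : P} {y : Y}
    (hy : y ∈ F p '' K p) : F p (ϑ p y) = y := by
  obtain ⟨x, hx, rfl⟩ := hy
  rw [hleft p x hx]

end Parametric

/-! ## §4  Compact-codomain editions (`C = univ`) -/

section CompactCodomain

variable [CompactSpace X] [T2Space Y] {F : P → X → Y} {K : P → Set X} {ϑ : P → Y → X}

/-- ★ Joint continuity of the parametrised inverse, compact codomain `X`. [cite: BourbakiGT1, Ch. I §10 no. 2, Thm 1 Cor. 5] -/
theorem continuousOn_parametricInverse_of_compactSpace (hW : IsClosed {q : P × X | q.2 ∈ K q.1})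
    (hF : ContinuousOn (fun q : P × X => F q.1 q.2) {q : P × X | q.2 ∈ K q.1})
    (hleft : ∀ p, ∀ x ∈ K p, ϑ p (F p x) = x) :
    ContinuousOn (fun q : P × Y => ϑ q.1 q.2) {q : P × Y | q.2 ∈ F q.1 '' K q.1} :=
  continuousOn_parametricInverse isCompact_univ (fun _ => subset_univ _) hW hF hleft

/-- The image graph is closed, compact codomain `X`. [cite: BourbakiGT1, Ch. I §10 no. 2, Thm 1 Cor. 5] -/
theorem isClosed_parametricImageGraph_of_compactSpace (hW : IsClosed {q : P × X | q.2 ∈ K q.1})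
    (hF : ContinuousOn (fun q : P × X => F q.1 q.2) {q : P × X | q.2 ∈ K q.1}) :
    IsClosed {q : P × Y | q.2 ∈ F q.1 '' K q.1} :=
  isClosed_parametricImageGraph isCompact_univ (fun _ => subset_univ _) hW hF

omit [T2Space Y] in
/-- Each image window is compact, compact codomain `X`. [cite: BourbakiGT1, Ch. I §9 no. 4, Thm 2 Cor. 1] -/
theorem isCompact_parametricImage_of_compactSpace (hW : IsClosed {q : P × X | q.2 ∈ K q.1})
    (hF : ContinuousOn (fun q : P × X => F q.1 q.2) {q : P × X | q.2 ∈ K q.1}) (p : P) : IsCompact (F p '' K p) :=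
  isCompact_parametricImage isCompact_univ (fun _ => subset_univ _) hW hF p

end CompactCodomain

end Literature.Topology.ParametricInverse
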